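import Mathlib.Topology.Homotopy.Lifting
import Mathlib.GroupTheory.Index
import Mathlib.Algebra.Group.Subgroup.Finite
import Literature.AlgebraicTopology.FundamentalGroup.CircleAndTorus
import HarnessLib

/-!
# The normal subgroup `p_* π₁(E) ⊴ π₁(X)` of a quotient covering and the conjugation action on it (Hatcher, Props. 1.31, 1.39, 1.40)

Topic `Literature/AlgebraicTopology/FundamentalGroup`.  Everything here is PROVED from Mathlib's
covering-space theory (`IsCoveringMap.injective_path_homotopic_map`,
`IsQuotientCoveringMap.fundamentalGroupToMulOpposite`, `ker_monodromyPerm`); no named facts.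
Written for the topological half of Serre 1964 ("le groupe `π₁(V_φ)` s'identifie au produit
semi-direct de `G` par `π₁(A_φ)`", `Literature/Barriers/HodgeConjecture/ConjugateVarietiesSerreTopologyProofs.lean`),
but general.

For a quotient covering map `p : E → X` of a group `G` acting on `E` (Mathlib
`IsQuotientCoveringMap p G`: `X = E/G`, the action free and "evenly covering") and a point `e`
over `x`:

* `mapOfEq_injective_of_isCoveringMap` — `p_* : π₁(E, e) → π₁(X, x)` is injective for ANY
  covering map (Hatcher, Prop. 1.31);
* `QuotientCovering.range_mapOfEq_eq_ker`, `QuotientCovering.normal_range_mapOfEq`,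
  `QuotientCovering.index_range_mapOfEq` — its image is the kernel
  of the monodromy homomorphism `π₁(X, x) → Gᵐᵒᵖ`, hence NORMAL, and of index `|G|` when `E` is path
  connected (Hatcher, Prop. 1.39 and Prop. 1.40(c): "`G(X̃) ≅ π₁(X)/p_*π₁(X̃)` if `X̃` is a normal
  covering");
* `twistedTransport T δ hT` (definition) — for a self-map `T` of `E`, a path `δ : e ⟶ e₁` and
  `T e₁ = e`, the self-map `β ↦ T ∘ (δ⁻¹ · β · δ)` of `π₁(E, e)`; `baseLoop p δ` — the loop
  `p ∘ δ ∈ π₁(X, p e)` when `p e₁ = p e`;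
* `map_twistedTransport_eq_conj` — **the conjugation action of `π₁(X)` on `p_* π₁(E)` is induced by
  the deck transformations**: if `p ∘ T = p` then `p_*(T ∘ (δ⁻¹ β δ)) = [p∘δ] · p_*β · [p∘δ]⁻¹`
  (the two loops coincide as maps `[0,1] → X`; Hatcher, Prop. 1.39: the action of `π₁(X, x₀)` on
  the fibre / on `p_*π₁` through lifts);
* `map_twistedTransport_of_semiconj` (naturality in maps intertwining `T`),
  `twistedTransport_eq_mapOfEq_conj`, `twistedTransport_eq_mapOfEq_of_comm`,
  `twistedTransport_eq_mapOfEq_of_comm'` (along a loop it is `T_*` of a conjugate, hence `T_*`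
  itself when `π₁(E, e)` is abelian);
* `bijective_map_snd_of_simplyConnectedSpace` — `π₁(Y × A, (y₀, a₀)) → π₁(A, a₀)` is bijective
  for `Y` simply connected (Hatcher, Prop. 1.12 with `π₁(Y) = 1`; from the tree's
  `fundamentalGroupProdEquiv`).

## References

* A. Hatcher, *Algebraic Topology*, CUP 2002: Prop. 1.12 (p. 34), Prop. 1.31 (p. 61),
  Prop. 1.39 (p. 71), Prop. 1.40 (p. 72). [HatcherAT2002]
-/

noncomputable section

namespace Literature.AlgebraicTopology.FundamentalGroup

section Covering

variable {E X : Type*} [TopologicalSpace E] [TopologicalSpace X] {p : E → X}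

/-- **A covering map is injective on `π₁`** (Hatcher, Prop. 1.31). [cite: HatcherAT2002, Prop. 1.31] -/
theorem mapOfEq_injective_of_isCoveringMap (hp : IsCoveringMap p) {x : X} (e : p ⁻¹' {x}) :
    Function.Injective (FundamentalGroup.mapOfEq ⟨p, hp.continuous⟩ e.2) := by
  obtain ⟨e, rfl⟩ := e
  intro γ γ' h
  rw [FundamentalGroup.mapOfEq_apply, FundamentalGroup.mapOfEq_apply,
    Path.Homotopic.Quotient.cast_rfl_rfl, Path.Homotopic.Quotient.cast_rfl_rfl] at h
  exact hp.injective_path_homotopic_map e e h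

variable {G : Type*} [Group G] [MulAction G E]

/-- **The image of `π₁` of the total space of a quotient covering is the kernel of the monodromy
homomorphism `π₁(X, x) → Gᵐᵒᵖ`** (Hatcher, Prop. 1.39/1.40). [cite: HatcherAT2002, Prop. 1.40] -/
theorem QuotientCovering.range_mapOfEq_eq_ker (hp : IsQuotientCoveringMap p G) {x : X} (e : p ⁻¹' {x}) :
    (FundamentalGroup.mapOfEq ⟨p, hp.isCoveringMap.continuous⟩ e.2).range =
      (hp.fundamentalGroupToMulOpposite e).ker := by
  rw [hp.ker_fundamentalGroupToMulOpposite e, hp.ker_monodromyPerm e]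

/-- Hence that image is a normal subgroup. [cite: HatcherAT2002, Prop. 1.39] -/
theorem QuotientCovering.normal_range_mapOfEq (hp : IsQuotientCoveringMap p G) {x : X} (e : p ⁻¹' {x}) :
    (FundamentalGroup.mapOfEq ⟨p, hp.isCoveringMap.continuous⟩ e.2).range.Normal := by
  rw [QuotientCovering.range_mapOfEq_eq_ker hp e]
  infer_instance

/-- **Its index is the order of the deck group** when the total space is path connected
(Hatcher, Prop. 1.39(c)/1.40: `π₁(X)/p_*π₁(E) ≅ G`). [cite: HatcherAT2002, Prop. 1.40] -/
theorem QuotientCovering.index_range_mapOfEq [PathConnectedSpace E] (hp : IsQuotientCoveringMap p G) {x : X}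
    (e : p ⁻¹' {x}) :
    (FundamentalGroup.mapOfEq ⟨p, hp.isCoveringMap.continuous⟩ e.2).range.index = Nat.card G := by
  rw [QuotientCovering.range_mapOfEq_eq_ker hp e, Subgroup.index_ker,
    MonoidHom.range_eq_top.2 (hp.fundamentalGroupToMulOpposite_surjective e), Subgroup.card_top]
  exact Nat.card_congr MulOpposite.opEquiv.symm

end Covering

section Conjugation

variable {E X : Type*} [TopologicalSpace E] [TopologicalSpace X]

/-- The **twisted transport** of loops at `e` along a path `δ : e ⟶ e₁` followed by a self-map
`T` of `E` with `T e₁ = e`: `β ↦ T ∘ (δ⁻¹ · β · δ)` (path order), a self-map of `π₁(E, e)`.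
For a deck transformation `T = g⁻¹` of a covering and `e₁ = g • e` this is the action of the
loop `p ∘ δ` of the base on `π₁(E, e) ⊴ π₁(X, p e)` by conjugation
(`map_twistedTransport_eq_conj`). [cite: HatcherAT2002, Prop. 1.39] -/
def twistedTransport (T : C(E, E)) {e e₁ : E} (δ : Path e e₁) (hT : T e₁ = e)
    (β : FundamentalGroup E e) : FundamentalGroup E e :=
  FundamentalGroup.fromPath
    ((((Path.Homotopic.Quotient.mk δ.symm).trans
      ((FundamentalGroup.toPath β).trans (Path.Homotopic.Quotient.mk δ))).map T).cast
        hT.symm hT.symm)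

/-- The loop `p ∘ δ` of the base attached to a path `δ : e ⟶ e₁` between two points of the
same fibre (`p e₁ = p e`), as an element of `π₁(X, p e)`. [folklore] -/
def baseLoop (p : C(E, X)) {e e₁ : E} (δ : Path e e₁) (h : p e₁ = p e) :
    FundamentalGroup X (p e) :=
  FundamentalGroup.fromPath (((Path.Homotopic.Quotient.mk δ).map p).cast rfl h.symm)

/-- **Conjugation in `π₁` of the base is twisted transport upstairs**: if `p ∘ T = p` and
`T e₁ = e`, then for every loop class `β` at `e`,
`p_* (T ∘ (δ⁻¹ · β · δ)) = [p ∘ δ] * p_* β * [p ∘ δ]⁻¹` in `π₁(X, p e)` (the two loops are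
literally the same map `[0,1] → X`). For a regular covering this is the statement that the
conjugation action of `π₁(X)` on the normal subgroup `p_* π₁(E)` is induced by the deck
transformations (Hatcher, Prop. 1.39). [cite: HatcherAT2002, Prop. 1.39] -/
theorem map_twistedTransport_eq_conj (p : C(E, X)) (T : C(E, E)) (hpT : ∀ z, p (T z) = p z)
    {e e₁ : E} (δ : Path e e₁) (hT : T e₁ = e) (β : FundamentalGroup E e) :
    FundamentalGroup.map p e (twistedTransport T δ hT β) =
      baseLoop p δ (by rw [← hpT e₁, hT]) * FundamentalGroup.map p e β *
        (baseLoop p δ (by rw [← hpT e₁, hT]))⁻¹ := by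
  obtain ⟨b, rfl⟩ := Path.Homotopic.Quotient.mk_surjective β
  change Path.Homotopic.Quotient.mk _ = Path.Homotopic.Quotient.mk _
  congr 1
  ext t
  simp only [Path.map_coe, Path.cast_coe, Path.trans_apply, Path.symm_apply,
    Function.comp_apply]
  split_ifs <;> simp [hpT]

end Conjugation

/-- **Twisted transport is natural** in maps intertwining the self-maps: if `φ ∘ T = T' ∘ φ`
then `φ_* (T ∘ (δ⁻¹ β δ)) = T' ∘ ((φδ)⁻¹ (φ_* β) (φδ))` (the same loop). [folklore] -/
theorem map_twistedTransport_of_semiconj {E E' : Type*} [TopologicalSpace E]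
    [TopologicalSpace E'] (φ : C(E, E')) (T : C(E, E)) (T' : C(E', E'))
    (h : ∀ z, φ (T z) = T' (φ z)) {e e₁ : E} (δ : Path e e₁) (hT : T e₁ = e)
    (β : FundamentalGroup E e) :
    FundamentalGroup.map φ e (twistedTransport T δ hT β) =
      twistedTransport T' (δ.map φ.continuous) (by rw [← h, hT]) (FundamentalGroup.map φ e β) := by
  obtain ⟨b, rfl⟩ := Path.Homotopic.Quotient.mk_surjective β
  change Path.Homotopic.Quotient.mk _ = Path.Homotopic.Quotient.mk _
  congr 1
  ext t
  simp only [Path.map_coe, Path.cast_coe, Path.trans_apply, Path.symm_apply,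
    Function.comp_apply]
  split_ifs <;> simp [h]

/-- Twisted transport along a LOOP `δ` is `T_*` of the conjugate `[δ] β [δ]⁻¹`. [folklore] -/
theorem twistedTransport_eq_mapOfEq_conj {E : Type*} [TopologicalSpace E] (T : C(E, E)) {e : E}
    (δ : Path e e) (hT : T e = e) (β : FundamentalGroup E e) :
    twistedTransport T δ hT β =
      FundamentalGroup.mapOfEq T hT
        (FundamentalGroup.fromPath (Path.Homotopic.Quotient.mk δ) * β *
          (FundamentalGroup.fromPath (Path.Homotopic.Quotient.mk δ))⁻¹) := by
  obtain ⟨b, rfl⟩ := Path.Homotopic.Quotient.mk_surjective β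
  rw [FundamentalGroup.mapOfEq_apply]
  rfl

/-- Hence, when `π₁(E, e)` is commutative, twisted transport along a loop is just `T_*`.
[folklore] -/
theorem twistedTransport_eq_mapOfEq_of_comm {E : Type*} [TopologicalSpace E] (T : C(E, E))
    {e : E} (δ : Path e e) (hT : T e = e)
    (hcomm : ∀ u v : FundamentalGroup E e, u * v = v * u) (β : FundamentalGroup E e) :
    twistedTransport T δ hT β = FundamentalGroup.mapOfEq T hT β := by
  rw [twistedTransport_eq_mapOfEq_conj, hcomm _ β, mul_assoc, mul_inv_cancel, mul_one]

/-- Variant of `twistedTransport_eq_mapOfEq_of_comm` for a path whose endpoint is only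
propositionally the base point. [folklore] -/
theorem twistedTransport_eq_mapOfEq_of_comm' {E : Type*} [TopologicalSpace E] (T : C(E, E))
    {e e₁ : E} (δ : Path e e₁) (he : e₁ = e) (hT : T e₁ = e) (hT' : T e = e)
    (hcomm : ∀ u v : FundamentalGroup E e, u * v = v * u) (β : FundamentalGroup E e) :
    twistedTransport T δ hT β = FundamentalGroup.mapOfEq T hT' β := by
  subst he
  exact twistedTransport_eq_mapOfEq_of_comm T δ hT hcomm β

/-- **The projection `π₁(Y × A, (y₀, a₀)) → π₁(A, a₀)` is an isomorphism for `Y` simply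
connected** (Hatcher, Prop. 1.12 with `π₁(Y) = 1`). [cite: HatcherAT2002, Prop. 1.12 (p. 34)] -/
theorem bijective_map_snd_of_simplyConnectedSpace {Y A : Type*} [TopologicalSpace Y]
    [TopologicalSpace A] [SimplyConnectedSpace Y] (y₀ : Y) (a₀ : A) :
    Function.Bijective
      (FundamentalGroup.map (⟨Prod.snd, continuous_snd⟩ : C(Y × A, A)) (y₀, a₀)) := by
  have key : ∀ γ, FundamentalGroup.map (⟨Prod.snd, continuous_snd⟩ : C(Y × A, A)) (y₀, a₀) γ =
      (fundamentalGroupProdEquiv y₀ a₀ γ).2 := fun γ ↦ rfl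
  constructor
  · intro γ γ' hγ
    apply (fundamentalGroupProdEquiv y₀ a₀).injective
    exact Prod.ext (Subsingleton.elim _ _) (by rw [← key, ← key, hγ])
  · intro β
    refine ⟨(fundamentalGroupProdEquiv y₀ a₀).symm (1, β), ?_⟩
    rw [key, MulEquiv.apply_symm_apply]

end Literature.AlgebraicTopology.FundamentalGroup

end
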